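import Mathlib
import HarnessLib
import Literature.MathematicalPhysics.QuantumFieldTheory.Balaban1983to89.B10

/-!
# `Balaban1983to89.B10Ineq3Terminal` — [Balaban1985UV3] p. 256, **(3)** from **(5)** at the terminal scale `k = K`:
# *"bounds are in uniform norms, and can be written in a simplest way as (3) χ(U)e^{−O(1)|T_ε|} ≤ ρ_K(U) ≤ e^{O(1)|T_ε|},
# |T_ε| = Σ_{x∈T_ε} ε³, with a constant O(1) depending on g and ε₀ only … The constant O(1) goes to ∞ as g → 0."*

T. Bałaban, *Ultraviolet stability of three-dimensional lattice pure gauge field theories*, Commun. Math. Phys. **102**,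
255–275 (1985) [Balaban1985UV3] (cell paper B10; journal page = PDF page + 254; p. 256 re-read on the render
`run/shared/lean/pub/pub-balaban/b2b-balaban-ref1/pages/1985-cmp102-uv-stability-3d/…-p002-x2.png`, 2026-08-21).

HONEST FRAMING (mega-formalization `lit-balaban`, verbatim): statement-level skeleton of published theorems with
citation tags; proofs where landed; nothing here is a claim about the Yang–Mills mass gap.

WHY THIS FILE EXISTS.  Unit `lit-balaban-r07` (reader/typer of B10, fold owner), gen 6; SKELETON row B10.Eq3.  The cell
module `…B10` types (5) (`B10.Bounds5`, `B10.Bounds5At`) and derives (5) from (41)/(47) (`bounds5At_of_ineqs`), but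
the *"simplest"* form (3) — the ε-UNIFORM bound on `ρ_K` alone, constant depending on `g` and `ε₀` — had no declaration
(row B10.Eq3 pointed at `B10DagLeaf.FineLattices`, which is a different statement).  Print presents (5) as the refinement of
(3) (*"To get a better bound we have to write explicitly the expression divergent with g"*); the passage (5)_K ⇒ (3)
uses the terminal-scale data `L^Kε = ε₀` (so `|T₁^{(K)}| = ε₀^{−3}|T_ε|`, `g_K = gε₀^{1/2}`) and ONE input print does not
spell out: on the support of `χ` (the small-field condition (4) on `T₁^{(K)}`) the minimal configuration `U_K(U)` of [7]
has action `A^η(U_K(U)) ≤ a·|T₁^{(K)}|` uniformly in ε (by the regularity of the minimizer, [7] = B11 Thm 1: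
`|U_K(∂p) − 1| ≤ O(1)ε₁η²`, `#plaquettes = 3η^{−3}|T₁^{(K)}|`, (11)) — typed here as the hypothesis `hreg`.

THE PRINTED TEXT (p. 256 [2], verbatim): *"The ultraviolet stability means that the actions ρ_K have bounds
independent of the lattice spacing ε. In our case field configurations have values in the compact Lie group G, hence
bounds are in uniform norms, and can be written in a simplest way as  χ(U)e^{−O(1)|T_ε|} ≤ ρ_K(U) ≤ e^{O(1)|T_ε|},
|T_ε| = Σ_{x∈T_ε} ε³, (3)  with a constant O(1) depending on g and ε₀ only. The function χ(U) is a characteristic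
function of the domain  |U(∂p) − 1| < ε₁, p ⊂ T₁^{(K)}, (4)  where ε₁ is a sufficiently small positive constant, which
will be chosen later. The constant O(1) goes to ∞ as g → 0. To get a better bound we have to write explicitly the
expression divergent with g. … (5) … where U_k(U) is the minimal configuration constructed in [7] … g_k = g(L^kε)^{1/2},
|T₁^{(k)}| = … = (L^kε)^{−3}|T_ε|"*; p. 256 l. 14–15: *"we terminate … when L^Kε = ε₀, where ε₀ is a positive constant
depending on the coupling constant g only"*.

DICTIONARY print ↦ Lean (`B10.RunData`): `ρ_K` ↦ `D.ρ D.K`, `χ` ↦ `D.χ D.K` ((4)), `A^η(U_K(U))` ↦ `D.wilsonBG D.K U`,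
`g_K` ↦ `D.g D.K`, `|T₁^{(K)}|` ↦ `D.sites D.K`, `|T_ε|` ↦ `Tε` with `D.sites D.K = ε₀^{−3}·Tε` (`hsites`); (5) at `k = K`
↦ `B10.Bounds5At D O1 D.K`; the regularity input ↦ `hreg : χ(U) ≠ 0 → A^η(U_K(U)) ≤ a·|T₁^{(K)}|`.

WHAT THIS FILE PROVES (kernel, no `sorry`, theorems only, no new definitions or named facts; axioms standard).
* `ineq3_of_bounds5At` — **(5)_K ⇒ (3)** with `O(1)_lower = ε₀^{−3}(O1 + a·g_K^{−2})`, `O(1)_upper = ε₀^{−3}·O1` explicit.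
* `ineq3_constant_eq` — with `g_K = gε₀^{1/2}`: `ε₀^{−3}(O1 + a·g_K^{−2}) = ε₀^{−3}(O1 + a/(g²ε₀))`, a function of `g` and
  `ε₀` only, as printed.
* `ineq3_constant_unbounded` — *"The constant O(1) goes to ∞ as g → 0"*: for `a > 0` and every `M` an explicit
  `g₀ > 0` with `ε₀^{−3}(O1 + a/(g²ε₀)) ≥ M` for all `0 < g ≤ g₀`.

Value = SKELETON row B10.Eq3 gains its kernel edge from (5); NOT summit progress.
-/

noncomputable section

namespace Literature.MathematicalPhysics.QuantumFieldTheory.Balaban1983to89.B10Ineq3Terminal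

open B10

/-- **(5) at `k = K` ⇒ (3)** (p. 256): with `|T₁^{(K)}| = ε₀^{−3}|T_ε|` (`L^Kε = ε₀`), `χ ≥ 0` and the minimizer-action
input `A^η(U_K(U)) ≤ a|T₁^{(K)}|` on the support of `χ`, the bounds (5) at the terminal scale give
`χ(U)·exp(−ε₀^{−3}(O1 + a·g_K^{−2})·|T_ε|) ≤ ρ_K(U) ≤ exp(ε₀^{−3}·O1·|T_ε|)`. [cite: Balaban1985UV3, (3) p.256] -/
theorem ineq3_of_bounds5At (D : RunData) {O1 a ε₀ Tε : ℝ}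
    (hsites : D.sites D.K = ε₀⁻¹ ^ 3 * Tε) (hχ0 : ∀ U : D.Cfg D.K, 0 ≤ D.χ D.K U)
    (hreg : ∀ U : D.Cfg D.K, D.χ D.K U ≠ 0 → D.wilsonBG D.K U ≤ a * D.sites D.K)
    (h5 : Bounds5At D O1 D.K) (U : D.Cfg D.K) :
    D.χ D.K U * Real.exp (-((ε₀⁻¹ ^ 3 * (O1 + a * (D.g D.K)⁻¹ ^ 2)) * Tε)) ≤ D.ρ D.K U ∧
      D.ρ D.K U ≤ Real.exp ((ε₀⁻¹ ^ 3 * O1) * Tε) := by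
  obtain ⟨hlow, hup⟩ := h5 U
  refine ⟨?_, ?_⟩
  · by_cases hχ : D.χ D.K U = 0
    · -- off the support of χ: 0 ≤ ρ_K, from the lower bound of (5) itself
      rw [hχ, zero_mul]
      rw [hχ, zero_mul] at hlow
      exact hlow
    · have hA := hreg U hχ
      refine le_trans ?_ hlow
      refine mul_le_mul_of_nonneg_left (Real.exp_le_exp.mpr ?_) (hχ0 U)
      have hg2 : 0 ≤ (D.g D.K)⁻¹ ^ 2 := sq_nonneg _
      have h1 : (D.g D.K)⁻¹ ^ 2 * D.wilsonBG D.K U ≤ (D.g D.K)⁻¹ ^ 2 * (a * D.sites D.K) :=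
        mul_le_mul_of_nonneg_left hA hg2
      rw [hsites] at h1 ⊢
      nlinarith
  · rw [hsites] at hup
    calc D.ρ D.K U ≤ Real.exp (O1 * (ε₀⁻¹ ^ 3 * Tε)) := hup
      _ = Real.exp ((ε₀⁻¹ ^ 3 * O1) * Tε) := by ring_nf

/-- The lower constant as a function of `g` and `ε₀` only (p. 256: *"with a constant O(1) depending on g and ε₀ only"*):
with `g_K = g(L^Kε)^{1/2} = gε₀^{1/2}`, `ε₀^{−3}(O1 + a·g_K^{−2}) = ε₀^{−3}(O1 + a/(g²ε₀))`. [cite: Balaban1985UV3, (3) p.256] -/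
theorem ineq3_constant_eq {g ε₀ O1 a gK : ℝ} (hε₀ : 0 < ε₀) (hgK : gK = g * Real.sqrt ε₀) :
    ε₀⁻¹ ^ 3 * (O1 + a * gK⁻¹ ^ 2) = ε₀⁻¹ ^ 3 * (O1 + a / (g ^ 2 * ε₀)) := by
  have h : (g * Real.sqrt ε₀)⁻¹ ^ 2 = (g ^ 2 * ε₀)⁻¹ := by
    rw [inv_pow, mul_pow, Real.sq_sqrt hε₀.le]
  rw [hgK, h, div_eq_mul_inv]

/-- *"The constant O(1) goes to ∞ as g → 0"* (p. 256), quantified: for `a > 0`, `ε₀ > 0` and every `M` there is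
`g₀ > 0` with `ε₀^{−3}(O1 + a/(g²ε₀)) ≥ M` for all `0 < g ≤ g₀` (explicitly `g₀ = (a/(ε₀·max(ε₀³M − O1, 1)))^{1/2}`).
[cite: Balaban1985UV3, (3) p.256] -/
theorem ineq3_constant_unbounded {ε₀ O1 a : ℝ} (hε₀ : 0 < ε₀) (ha : 0 < a) (M : ℝ) :
    ∃ g₀ : ℝ, 0 < g₀ ∧ ∀ g : ℝ, 0 < g → g ≤ g₀ → M ≤ ε₀⁻¹ ^ 3 * (O1 + a / (g ^ 2 * ε₀)) := by
  set M₁ : ℝ := max (ε₀ ^ 3 * M - O1) 1 with hM₁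
  have hM₁pos : 0 < M₁ := lt_of_lt_of_le one_pos (le_max_right _ _)
  refine ⟨Real.sqrt (a / (ε₀ * M₁)), Real.sqrt_pos.mpr (by positivity), fun g hg hgle => ?_⟩
  -- g ≤ g₀ ⇒ g²ε₀ ≤ a/M₁ ⇒ a/(g²ε₀) ≥ M₁ ≥ ε₀³M − O1
  have hg2 : g ^ 2 ≤ a / (ε₀ * M₁) := by
    have h := pow_le_pow_left₀ hg.le hgle 2
    rwa [Real.sq_sqrt (by positivity)] at h
  have hden : 0 < g ^ 2 * ε₀ := by positivity
  have hkey : M₁ ≤ a / (g ^ 2 * ε₀) := by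
    rw [le_div_iff₀ hden]
    have := mul_le_mul_of_nonneg_right hg2 (by positivity : (0 : ℝ) ≤ ε₀ * M₁)
    rw [div_mul_cancel₀ _ (by positivity : ε₀ * M₁ ≠ 0)] at this
    nlinarith
  have hM1 : ε₀ ^ 3 * M - O1 ≤ M₁ := le_max_left _ _
  have hε3 : 0 < ε₀ ^ 3 := by positivity
  have hinv : ε₀⁻¹ ^ 3 = (ε₀ ^ 3)⁻¹ := by rw [inv_pow]
  rw [hinv, ← div_eq_inv_mul, le_div_iff₀ hε3]
  nlinarith

end Literature.MathematicalPhysics.QuantumFieldTheory.Balaban1983to89.B10Ineq3Terminal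

end
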